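import Literature.IUT.HodgeArakelov.ThetaEnvDataRecordAutOfRootHyp
import Literature.IUT.HodgeArakelov.EtaleThetaDataOfSettingAutActionKummer

/-!
# [IUTchII] Prop 3.4 (i) at the GENUINE data with the GENUINE constant-monoid Kummer map: all four binders of
# `prop34i_multiradiallyDefined_genuine` in print's shape

S. Mochizuki, *Inter-universal Teichmüller theory II*, kurims manuscript (Dec. 2020): Prop 3.4 (i) pp. 91–92
[cite: Mochizuki2012, Prop 3.4 (i) p.91]; Prop 3.1 (ii) p. 88 («`Ψ_cns(M^Θ_*) := M_TM(M^Θ_*)`»); Prop 2.2 (i) p. 66; Prop 1.4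
p. 27.  Claim key DISPUTED (D-0012).  [EtTh] (refereed): Cor. 2.18 (i) p. 60 (= F-0620, BY NAME), Cor. 2.19 (iii) p. 65;
[AbsTopIII] Prop. 3.2 p. 71.  abc-iut cell, layer L6, WAVE-5 seat abc-iut-w5-d169, holder sub-row «P34i-GENUINE-(P1)» of DAG
node IUTchII:Prop3.4(i) (L6-lead §F v1.19s); `plan/L6/SUBDAG-IUTchII-Prop-31-33-34.md`; GAP rows G-w5d169-1, G-w5d169-2, G-w5d169-3.

PROOF-ONLY corollary (no definitions, no `Prop`-valued definition, no named fact) of abc-iut-w5-d169's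
`ThetaEnvDataRecordAutOfRootHyp.lean` (p432788) and `EtaleThetaDataOfSettingAutActionKummer.lean` (p433365): take the
constant-monoid Kummer map of the record to be abc-iut-w4-d007's GENUINE `κ := h1LimKummerOn (phi C) (l·Δ_Θ) (Π^tp_Ÿ̲̲) c O`
of a `Π^tp_X̲̲`-module of constants `A` (at the model: `ℚ̄_pˣ` through `ε`) and a submonoid `O` (`𝒪^▷`), with cyclotome
coefficients `c : Λ(A) → l·Δ_Θ`.  Then binder (P3) `hκ` is `map_mrange_h1LimKummerOn_eq_of_semilinear`, i.e. FOLLOWS from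
**`hsemi`**: for every `α ∈ Aut_top(Π^tp_X̲̲)` an automorphism `e_α` of the constants, semilinear over `α`, compatible with the
cyclotomic rigidity (`c ∘ Λ(e_α) = rangeAut α ∘ c`) and carrying `O` onto itself — [AbsTopIII] Prop. 3.2 (i)(ii)(iv)
functoriality of `Π ↦ (Π ↷ M_TM(Π), κ)`.
* **`EtaleLevels.prop34i_multiradiallyDefined_ofKummer`** — [IUTchII] Prop 3.4 (i) multiradiality AT THE GENUINE FUNCTOR,
  genuine Kummer map, `ι` over the orbit of `ρ_{ι₀}`; residual exactly: F-0620 (FACT) · `hq` · `hconj` (G-w5d169-1) ·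
  `hroot` (G-w5d169-2) · `hsemi` (G-w5d169-3) · the record's standing inputs (`mods`, `hmods`, `h15`, `L`, `hZ`, `hcharY`,
  `hlim`) and the Kummer data (`c`, `hopen`, `hfi`).
Nothing here asserts anything of [IUTchII]; no side taken on [IUTchIII] Cor 3.12; typed ≠ proved.
-/

noncomputable section

open Topology

namespace Literature.IUT.HodgeArakelov

open Literature.AnabelianGeometry.EtaleTheta Literature.AnabelianGeometry.SemiGraphs
open CohomologySystemOfContH1 EtaleThetaDataOfSetting TemperedThetaMonoids
open scoped Literature.AnabelianGeometry.EtaleTheta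

namespace EtaleLevels

variable {p : ℕ} [Fact p.Prime] {D : Literature.AnabelianGeometry.EtaleTheta.ThetaSetting p}
  {E : D.EtaleThetaData} {l : ℕ} (C : E.DoubleUnderline l) (hC : D.Compat) (hS : D.Sec2Hyps)
  (hl : l.Prime) (hp2 : p ≠ 2) (hpl : p ≠ l) (hζ : ∃ ζ : D.K, IsPrimitiveRoot ζ (4 * l))
  (mods : ∀ M : ℕ+, D.CyclotomeMod l M)
  (f : contCocycles D.toTheta D.DeltaTheta C.GtpYdduu) (hf : f ∈ C.rootCocycles hC)
  (hmods : ∀ (M M' : ℕ+) (h : (M : ℕ) ∣ (M' : ℕ)) (x : D.lDeltaTheta l),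
    MuN.red p M M' h ((mods M').red x) = (mods M).red x)
  (h15 : Literature.AnabelianGeometry.EtaleTheta.ThetaSetting.Prop15iii E hC) (L : C.CuspLabels)
  (hZ : ∀ M : ℕ+, Nonempty (ModelCyclotomes.lDeltaQuot (C.rigidData (mods M) hC hS h15 L) ≃*
    Literature.IUT.HodgeTheaters.ZHat))
  (hcharY : EtaleThetaDataOfSetting.PiYddCharacteristic C)
  (hlim : Function.Bijective (rigidLimHom C hC hS hl hp2 hpl hζ mods f hf hmods h15 L hZ))
  [(EtaleThetaDataOfSetting.PiYdd C).Normal]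
  (hq : IsQuotientMap D.toTheta) {N : ℕ+} (μ : D.CyclotomeMod l N)
  (R : RigidData.{0} N l) (hR : R = C.rigidData μ hC hS h15 L) (h218i : R.Cor218_i)
  (hroot : ∀ α : (Pi C) ≃ₜ* (Pi C), ∃ τ : Pi C, ∃ ε : (coh C).H1 ⊤, l • ε = 0 ∧
    autActTopOfCor218i C hq μ hC hS h15 L R hR h218i α (rootTop C) =
      h1TopConjEquiv (phi C) (D.lDeltaTheta l) (PiYdd C) τ (rootTop C) + ε)
  (ι₀ : (Pi C) ≃ₜ* (Pi C))
  (hconj : ∀ α : (Pi C) ≃ₜ* (Pi C), ∃ c : Pi C, ∀ g, α (ι₀ (α.symm g)) = c * ι₀ (c⁻¹ * g * c) * c⁻¹)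
  {A : Type} [CommGroup A] [MulDistribMulAction (Pi C) A] [TopologicalSpace A] [RootableBy A ℕ]
  (cyc : CyclotomeCoefficients (phi C) (D.lDeltaTheta l) A)
  (hopen : ∀ b : A, IsOpen (MulAction.stabilizer (Pi C) b : Set (Pi C)))
  (hfi : ∀ b : A, (MulAction.stabilizer (Pi C) b).FiniteIndex) (O : Submonoid A)
  (hsemi : ∀ α : (Pi C) ≃ₜ* (Pi C), ∃ e : A ≃* A,
    (∀ (x : Pi C) (a : A), x • e a = e (α.symm x • a)) ∧
    (∀ ζ : cyclotome A, ((cyc.hom (cyclotome.map e.toMonoidHom ζ) : D.lDeltaTheta l) : D.GtpTheta) =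
      ((rangeAutOfCor218i C μ hq hC hS h15 L R hR h218i α
        ⟨(cyc.hom ζ : D.GtpTheta), lDeltaTheta_le_phiRange C (cyc.hom ζ).2⟩ : phiRange C) : D.GtpTheta)) ∧
    (∀ a, a ∈ O ↔ e a ∈ O))

/-- **[IUTchII] Prop 3.4 (i) — MULTIRADIALITY OF SPLIT THETA MONOIDS AT THE GENUINE FUNCTOR with the GENUINE constant-monoid
Kummer map `κ = h1LimKummerOn c O`** (`Ψ_cns := M_TM`, abc-iut-w4-d007), `ι` ranging over the `Π^tp_{X̲̲}`-conjugacy orbit of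
`ρ_{ι₀}`; ALL FOUR ad-hoc binders of p423712 replaced by print-shaped statements: (P1) := {[EtTh] Cor. 2.18 (i) = F-0620,
`hq`}; (P2) := `hconj` (G-w5d169-1); (P3) := `hsemi` ([AbsTopIII] Prop. 3.2 functoriality, G-w5d169-3); (P4) := `hroot`
([EtTh] Cor. 2.19 (iii), G-w5d169-2). [cite: Mochizuki2012, Prop 3.4 (i) p.92] -/
theorem prop34i_multiradiallyDefined_ofKummer
    {η : (C.thetaEnvData μ hC hS).PiYdd → MuN p N} (hη : η ∈ (C.thetaEnvData μ hC hS).thetaCocycles)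
    (Γ : Type) [Group Γ] :
    ((ex18iii (ThetaSetting.ofDoubleUnderline C μ hC hS hl hp2 hpl hζ hη) Γ).toDagger
      (TemperedThetaMonoids.prop34iRadialFunctor
        (thetaEnvTransportI C hC hS hl hp2 hpl hζ mods f hf hmods h15 L hZ hcharY hlim hq μ R hR h218i
          (h1LimKummerOn (phi C) (D.lDeltaTheta l) (PiYdd C) cyc hopen hfi O)
          (autActOfCor218i C hq μ hC hS h15 L R hR h218i ι₀)
          (orbitHyp_of_iotaConj C hq μ hC hS h15 L R hR h218i ι₀ hconj)
          (map_mrange_h1LimKummerOn_eq_of_semilinear C hq cyc hopen hfi μ hC hS h15 L R hR h218i O hsemi)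
          (image_toLim_theta_thetaEnvData_of_rootHyp C hC hS hl hp2 hpl hζ mods f hf hmods h15 L hZ hcharY hlim hq
            μ R hR h218i hroot)
          (image_thetaInfty_thetaEnvData_of_rootHyp C hC hS hl hp2 hpl hζ mods f hf hmods h15 L hZ hcharY hlim hq μ
            R hR h218i hroot) hη)
        Γ)).IsMultiradiallyDefined :=
  prop34i_multiradiallyDefined_ofRootHyp C hC hS hl hp2 hpl hζ mods f hf hmods h15 L hZ hcharY hlim hq μ R hR h218i hroot
    _ ι₀ hconj _ hη Γ

end EtaleLevels

end Literature.IUT.HodgeArakelov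

end
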